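import Summits.MatrixMultiplication.OmegaCensus.SmallFormats.RankOnePlaneCapGeneral
import HarnessLib

/-!
# ω-census family (a): the rank-one plane cap on the Y-side and on the output side (cyclic rotation)

Cell `pub-omega` (unit `pub-omega-lit`, gen 5), topic `Summits/MatrixMultiplication/OmegaCensus`
(sub-folder `SmallFormats`). Framing (verbatim): lottery ticket; floor = certified bounds/negative
ranges. HONEST FRAMING: the cyclic-rotation images of our elementary lemma
`RankOnePlaneCapGeneral.card_vanishing_add_lt`; caps for structured searches, not rank bounds, not
progress on `ω`.

**Rotation** (`exists_rotate`): a bilinear computation `XY = ∑ f_i(X) g_i(Y) W_i` of `⟨c,m,n⟩` yields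
the computation `YZ' = ∑ g_i(Y) h_i(Z') F_iᵀ` of `⟨m,n,c⟩`, where `h_i(Z') = ∑ W_i κ ν · Z' ν κ`
(`= tr(W_i Z')`) and `F_i κ μ = f_i(E_{κμ})` — the cyclic symmetry `tr(XYZ') = tr(YZ'X)` inside the
tree's `BilinComp` framework. Consequences for `⟨c,m,n⟩` (from the general cap applied to the rotated
computations):
* `card_gVanishing_add_lt` (Y-side, needs `m ≥ 2`, `r < 2nc`): the Y-forms vanishing on
  `{λ zᵀ : z ∈ k^n} ⊂ k^{m×n}` (`λ ∈ k^m ∖ 0`) number `≤ r − nc − 1`;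
* `card_wRowPlane_add_lt` (output side, needs `c ≥ 2`, `r < 2nm`): the outputs `W_i` with
  `λᵀ W_i = 0` (all columns of `W_i` orthogonal to `λ ∈ k^c ∖ 0`, i.e. `W_i` in a rank-one output plane
  `{μ wᵀ}`) number `≤ r − nm − 1`.
Census instance `⟨2,2,5⟩ @ 17`: at most `6` Y-forms read a single row-combination of `Y`, and at most
`6` outputs lie in a single row-plane of the output (substitution / separation: `7` each).
-/

namespace Summit.MatrixMultiplication.OmegaCensus.RankOnePlaneCapGeneral

open Module Matrix Literature.Computability.AlgebraicComplexity

variable {k : Type*} [Field k] {c m n : ℕ} {ι : Type*} [Fintype ι]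

/-- **Cyclic rotation** `⟨c,m,n⟩ → ⟨m,n,c⟩` of a bilinear computation: first forms `g_i`, second forms
`Z' ↦ ∑ W_i κ ν · Z' ν κ`, outputs `F_iᵀ` with `F_i κ μ = f_i(E_{κμ})`. -/
theorem exists_rotate (β : BilinComp (mulBilin k c m n) ι) :
    ∃ β' : BilinComp (mulBilin k m n c) ι,
      (∀ i, β'.f i = β.g i) ∧
      (∀ i Z', β'.g i Z' = ∑ κ, ∑ ν, β.w i κ ν * Z' ν κ) ∧
      (∀ i, β'.w i = Matrix.of fun μ κ => β.f i (Matrix.single κ μ (1 : k))) := by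
  classical
  refine ⟨{ f := β.g
            g := fun i =>
              { toFun := fun Z' => ∑ κ, ∑ ν, β.w i κ ν * Z' ν κ
                map_add' := fun Z Z' => by
                  simp only [Matrix.add_apply, mul_add, Finset.sum_add_distrib]
                map_smul' := fun a Z => by
                  simp only [Matrix.smul_apply, smul_eq_mul, RingHom.id_apply, Finset.mul_sum]
                  exact Finset.sum_congr rfl fun κ _ => Finset.sum_congr rfl fun ν _ => by ring }
            w := fun i => Matrix.of fun μ κ => β.f i (Matrix.single κ μ (1 : k))
            map_eq_sum := ?_ }, fun i => rfl, fun i Z' => rfl, fun i => rfl⟩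
  intro Y Z'
  rw [mulBilin_apply]
  ext μ κ
  have hβ : ∀ κ' ν, (∑ i, (β.f i (Matrix.single κ μ (1 : k)) * β.g i Y) * β.w i κ' ν)
      = if κ' = κ then Y μ ν else 0 := by
    intro κ' ν
    have h := β.map_eq_sum (Matrix.single κ μ (1 : k)) Y
    rw [mulBilin_apply] at h
    have h2 := congrFun (congrFun h κ') ν
    rw [single_mul_apply'] at h2
    rw [h2, Matrix.sum_apply]
    exact Finset.sum_congr rfl fun i _ => by simp
  simp only [LinearMap.coe_mk, AddHom.coe_mk, Matrix.sum_apply, Matrix.smul_apply, Matrix.of_apply,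
    smul_eq_mul]
  calc (Y * Z') μ κ = ∑ ν, Y μ ν * Z' ν κ := Matrix.mul_apply
    _ = ∑ κ', ∑ ν, Z' ν κ' * (if κ' = κ then Y μ ν else 0) := by
        rw [Finset.sum_eq_single κ]
        · simp [mul_comm]
        · intro κ' _ hne
          simp [hne]
        · intro h; exact absurd (Finset.mem_univ κ) h
    _ = ∑ κ', ∑ ν, Z' ν κ' * ∑ i, (β.f i (Matrix.single κ μ (1 : k)) * β.g i Y) * β.w i κ' ν := by
        simp_rw [hβ]
    _ = ∑ κ', ∑ ν, ∑ i, Z' ν κ' * ((β.f i (Matrix.single κ μ (1 : k)) * β.g i Y) * β.w i κ' ν) := by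
        simp_rw [Finset.mul_sum]
    _ = ∑ κ', ∑ i, ∑ ν, Z' ν κ' * ((β.f i (Matrix.single κ μ (1 : k)) * β.g i Y) * β.w i κ' ν) :=
        Finset.sum_congr rfl fun κ' _ => Finset.sum_comm
    _ = ∑ i, ∑ κ', ∑ ν, Z' ν κ' * ((β.f i (Matrix.single κ μ (1 : k)) * β.g i Y) * β.w i κ' ν) :=
        Finset.sum_comm
    _ = ∑ i, (β.g i Y * ∑ κ', ∑ ν, β.w i κ' ν * Z' ν κ') * β.f i (Matrix.single κ μ (1 : k)) := by
        refine Finset.sum_congr rfl fun i _ => ?_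
        rw [Finset.mul_sum, Finset.sum_mul]
        refine Finset.sum_congr rfl fun κ' _ => ?_
        rw [Finset.mul_sum, Finset.sum_mul]
        exact Finset.sum_congr rfl fun ν _ => by ring

/-- **Y-side rank-one plane cap.** In a bilinear computation of `⟨c,m,n⟩` (`m ≥ 2`) of length
`r < 2nc`, a set `R` of indices whose Y-forms vanish on the plane `{λ zᵀ : z ∈ k^n} ⊂ k^{m×n}`
(`λ ∈ k^m ∖ 0`; all columns parallel to `λ` — e.g. for `λ = e_μ₀` these are the Y-forms that do not
read row `μ₀` of `Y`) has `|R| + nc + 1 ≤ r` (substitution alone: `|R| + nc ≤ r`). -/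
theorem card_gVanishing_add_lt (hm : 2 ≤ m) (hr : Fintype.card ι < 2 * (n * c))
    (β : BilinComp (mulBilin k c m n) ι) {lam : Fin m → k} (hlam : lam ≠ 0) (R : Finset ι)
    (hR : ∀ i ∈ R, ∀ z : Fin n → k, β.g i (vecMulVec lam z) = 0) :
    R.card + n * c + 1 ≤ Fintype.card ι := by
  obtain ⟨β', hf, -, -⟩ := exists_rotate β
  refine card_vanishing_add_lt hm hr β' hlam R fun i hi z => ?_
  rw [hf]
  exact hR i hi z

/-- **Output-side rank-one plane cap.** In a bilinear computation of `⟨c,m,n⟩` (`c ≥ 2`) of length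
`r < 2nm`, a set `R` of indices whose outputs satisfy `λᵀ W_i = 0` (`λ ∈ k^c ∖ 0`; `W_i` lies in the
rank-one output plane of matrices whose columns are orthogonal to `λ`) has `|R| + nm + 1 ≤ r`.
(Separation alone — project the output along that plane — gives `|R| + nm ≤ r`.) -/
theorem card_wRowPlane_add_lt (hc : 2 ≤ c) (hr : Fintype.card ι < 2 * (n * m))
    (β : BilinComp (mulBilin k c m n) ι) {lam : Fin c → k} (hlam : lam ≠ 0) (R : Finset ι)
    (hR : ∀ i ∈ R, lam ᵥ* β.w i = 0) :
    R.card + n * m + 1 ≤ Fintype.card ι := by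
  classical
  obtain ⟨β', -, hg, -⟩ := exists_rotate β
  obtain ⟨β'', hf'', -, -⟩ := exists_rotate β'
  -- `β''` computes `⟨n,c,m⟩`; its X-forms are `h_i : Z' ↦ ∑ W_i κ ν Z' ν κ`; apply the column cap
  refine card_vanishing_col_add_lt hc hr β'' hlam R fun i hi z => ?_
  rw [hf'', hg]
  have h0 := hR i hi
  calc ∑ κ, ∑ ν, β.w i κ ν * vecMulVec z lam ν κ
      = ∑ ν, z ν * (lam ᵥ* β.w i) ν := by
          rw [Finset.sum_comm]
          refine Finset.sum_congr rfl fun ν _ => ?_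
          simp only [Matrix.vecMul, dotProduct, vecMulVec_apply, Finset.mul_sum]
          exact Finset.sum_congr rfl fun κ _ => by ring
    _ = 0 := by simp [h0]

/-- **Census instance `⟨2,2,5⟩ @ 17`, Y-side and output side**: in a 17-term algorithm for
`⟨2,2,5⟩`, for every `λ ∈ k² ∖ 0` at most `6` Y-forms vanish on `{λ zᵀ : z ∈ k⁵}` and at most `6`
outputs `W_i` have `λᵀ W_i = 0`. -/
theorem card_le_six_225_Y_and_W {ι : Type*} [Fintype ι] (h17 : Fintype.card ι = 17)
    (β : BilinComp (mulBilin k 2 2 5) ι) {lam : Fin 2 → k} (hlam : lam ≠ 0) (R R' : Finset ι)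
    (hR : ∀ i ∈ R, ∀ z : Fin 5 → k, β.g i (vecMulVec lam z) = 0)
    (hR' : ∀ i ∈ R', lam ᵥ* β.w i = 0) :
    R.card ≤ 6 ∧ R'.card ≤ 6 := by
  have h1 := card_gVanishing_add_lt (le_refl 2) (by rw [h17]; norm_num) β hlam R hR
  have h2 := card_wRowPlane_add_lt (le_refl 2) (by rw [h17]; norm_num) β hlam R' hR'
  constructor <;> omega

end Summit.MatrixMultiplication.OmegaCensus.RankOnePlaneCapGeneral
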